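import Summits.CriticalPhenomena.PercolationContinuityZ3.Theorems.PercNearOneGluingNoHeavyQuantIndepBlobGapCalculus
import HarnessLib

/-!
# QUANT lane R8, FAR on general trees — the GAP CALCULUS for independent blobs (III): MATCHED COMPANIONS — a light blob
# paired with a heavy companion of at least its size and `odds(p)·odds(g) ≥ odds(x)` ADDS ITS FULL SIZE to the gap parameter

builds on p205010 (kernel theorem, internal audit signed; external expert review pending)

Support file (`--supports stmt-CriticalPhenomena-4575`), QUANT lane lead (gen 16), rung R8 of
`run/shared/lean/prim/quant/LADDER.md`; memo `run/shared/lean/prim/quant/prim-quant-lead-g16/LEAD-NOTES-G16.md` N30–N31.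
Theorems only, no definitions, no sorries, standard axioms.  Vocabulary (restricted tail `TL_U`, gap property) as in part (I),
`…QuantIndepBlobGapCalculus`; part (II) is `…QuantIndepBlobGapCompanion`.

Part (I) showed that a HEAVY blob adds its size to the gap parameter (`gap_insert`) and a light blob alone adds nothing.  Here:
a light blob `ℓ` (ANY gate `g`) inserted TOGETHER with a heavy companion `k` (`x ≤ p ≤ 1`, `a ℓ ≤ a k`,
`x(1 − p)(1 − g) ≤ (1 − x)·p·g`, i.e. `odds(p)·odds(g) ≥ odds(x)`) adds the FULL `a k + a ℓ`.  Mechanism: the law of the pair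
`{k, ℓ}` is an explicit convex combination of five laws 'sure mass `s` plus one floor blob `d`' with `2s + d ≥ a k + a ℓ`
(`(0, a+b)`, `(b, a)`, `(b, a−b)`, `(a, 0)`, `(a+b, 0)`; the one free weight is `θ = max(0, (r(1−p) − pg)/x)`, `r = x/(1−x)`), and each
such law acts on the tail of the rest by a sure SHIFT and one abstract floor-blob EXTENSION, both of which raise the gap parameter
(`gapFun_shift`, `gapFun_extend` — the function-level form of part (I)'s one-blob lemma).  Consequences:

* `Quant.IndepBlob.gapFun_extend`, `gapFun_shift` — the abstract (function-level) extension and shift lemmas.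
* `Quant.IndepBlob.gap_insert_pair` — **THE PAIR EXTENSION LEMMA**: GAP(U, E) ⟹ GAP(U + k + ℓ, E + a k + a ℓ) under the conditions above.
* `Quant.IndepBlob.gap_union_pairs` — a finset `L` of lights MATCHED injectively to companions `c ℓ` (outside `L` and the base) adds
  `Σ_{ℓ ∈ L} (a ℓ + a (c ℓ))`.
* `Quant.IndepBlob.tail_ge_of_matched_companions` — **THE MATCHING ROW** (credit-free): if every non-heavy blob `ℓ ∈ L` has its own
  heavy companion `c ℓ` (`c` injective on `L`, `c ℓ ∉ L`) with `a ℓ ≤ a (c ℓ)` and `odds(p (c ℓ))·odds(p ℓ) ≥ odds(x)`, all other blobs are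
  heavy, and the sizes total `≥ 2j + 1`, then `x ≤ P(N ≥ j+1)`.  With all light gates `≥ 1/2` the odds condition is automatic, so:
  **lights of gate `≥ 1/2` that can be matched to distinct heavy blobs at least their size count at FULL size in the size row.**
  This is a Hall-type sufficient condition for the multi-light corner of Conjecture DIB\* (`…QuantDIBStarCorner`), complementary to
  p1 g11's graded merge (`…QuantIndepBlobGradedMerge`) and to part (II)'s single companion for a whole cloud.

[this work]; the gluing rows served: [cite: KozmaNitzan2024, Conjecture 3 (p. 15)].
-/

namespace Summit.CriticalPhenomena.PercolationContinuityZ3.Theorems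

namespace Quant

namespace IndepBlob

open Finset

variable {κ : Type*} [DecidableEq κ]

/-! ### 1. Function-level extension and shift -/

/-- **Abstract one-blob extension.**  For an antitone `T : ℕ → ℝ` with `T 0 = 1`, `T ≥ 0` and the gap property at `E`
(`x ≤ x·T y + (1 − x)·T v` for `y ≤ v`, `y + v ≤ E + 1`), a floor `1/2 ≤ x` and a gate `x ≤ q ≤ 1`, the function
`t ↦ q·T(t − b) + (1 − q)·T(t)` has the gap property at `E + b`.  (The proof of part (I)'s `gap_insert`, verbatim at function level.)
[this work] -/
theorem gapFun_extend (x : ℝ) (hx : 1 / 2 ≤ x) (T : ℕ → ℝ) (hT0 : T 0 = 1) (hTnn : ∀ t, 0 ≤ T t)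
    (hTanti : ∀ t t' : ℕ, t ≤ t' → T t' ≤ T t) (E : ℕ)
    (hU : ∀ y v : ℕ, y ≤ v → y + v ≤ E + 1 → x ≤ x * T y + (1 - x) * T v)
    (q : ℝ) (hqx : x ≤ q) (hq1 : q ≤ 1) (b : ℕ) :
    ∀ y v : ℕ, y ≤ v → y + v ≤ E + b + 1 →
      x ≤ x * (q * T (y - b) + (1 - q) * T y) + (1 - x) * (q * T (v - b) + (1 - q) * T v) := by
  intro y v hyv hsum
  have hx0 : 0 ≤ x := by linarith
  have h1x : 0 ≤ 1 - x := by linarith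
  have P1 : x ≤ x * T (y - b) + (1 - x) * T v := by
    by_cases hby : b ≤ y
    · exact hU (y - b) v (by omega) (by omega)
    · have h0 : y - b = 0 := by omega
      rw [h0, hT0]
      nlinarith [hTnn v]
  have P3 : x ≤ x * T (y - b) + (1 - x) * T (v - b) := by
    by_cases hby : b ≤ y
    · exact hU (y - b) (v - b) (by omega) (by omega)
    · have h0 : y - b = 0 := by omega
      rw [h0, hT0]
      nlinarith [hTnn (v - b)]
  have hRx : x ≤ x * (x * T (y - b) + (1 - x) * T y) + (1 - x) * (x * T (v - b) + (1 - x) * T v) := by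
    have hmax : T v ≤ T (v - b) := hTanti _ _ (Nat.sub_le v b)
    have hmax' : T v ≤ T y := hTanti _ _ hyv
    by_cases hyb : y ≤ v - b
    · have P2 : x ≤ x * T y + (1 - x) * T (v - b) := hU y (v - b) hyb (by omega)
      have hA : x * x ≤ x * (x * T (y - b) + (1 - x) * T v) := mul_le_mul_of_nonneg_left P1 hx0
      have hB : (1 - x) * x ≤ (1 - x) * (x * T y + (1 - x) * T (v - b)) := mul_le_mul_of_nonneg_left P2 h1x
      have hdiff : x * (x * T (y - b) + (1 - x) * T y) + (1 - x) * (x * T (v - b) + (1 - x) * T v) -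
          (x * (x * T (y - b) + (1 - x) * T v) + (1 - x) * (x * T y + (1 - x) * T (v - b))) =
          (1 - x) * (2 * x - 1) * (T (v - b) - T v) := by ring
      have hC : 0 ≤ (1 - x) * (2 * x - 1) * (T (v - b) - T v) :=
        mul_nonneg (mul_nonneg h1x (by linarith)) (by linarith)
      nlinarith [hA, hB, hC, hdiff]
    · have P2 : x ≤ x * T (v - b) + (1 - x) * T y := by
        by_cases hbv : b ≤ v
        · exact hU (v - b) y (by omega) (by omega)
        · have h0 : v - b = 0 := by omega
          rw [h0, hT0]
          nlinarith [hTnn y]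
      have hA : x * x ≤ x * (x * T (y - b) + (1 - x) * T v) := mul_le_mul_of_nonneg_left P1 hx0
      have hB : (1 - x) * x ≤ (1 - x) * (x * T (v - b) + (1 - x) * T y) := mul_le_mul_of_nonneg_left P2 h1x
      have hdiff : x * (x * T (y - b) + (1 - x) * T y) + (1 - x) * (x * T (v - b) + (1 - x) * T v) -
          (x * (x * T (y - b) + (1 - x) * T v) + (1 - x) * (x * T (v - b) + (1 - x) * T y)) =
          (1 - x) * (2 * x - 1) * (T y - T v) := by ring
      have hC : 0 ≤ (1 - x) * (2 * x - 1) * (T y - T v) :=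
        mul_nonneg (mul_nonneg h1x (by linarith)) (by linarith)
      nlinarith [hA, hB, hC, hdiff]
  have hkey : (1 - x) * (x * (q * T (y - b) + (1 - q) * T y) + (1 - x) * (q * T (v - b) + (1 - q) * T v) - x) =
      (1 - q) * (x * (x * T (y - b) + (1 - x) * T y) + (1 - x) * (x * T (v - b) + (1 - x) * T v) - x) +
      (q - x) * (x * T (y - b) + (1 - x) * T (v - b) - x) := by ring
  have hprod1 : 0 ≤ (1 - q) * (x * (x * T (y - b) + (1 - x) * T y) + (1 - x) * (x * T (v - b) + (1 - x) * T v) - x) :=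
    mul_nonneg (by linarith) (by linarith)
  have hprod2 : 0 ≤ (q - x) * (x * T (y - b) + (1 - x) * T (v - b) - x) := mul_nonneg (by linarith) (by linarith)
  rcases eq_or_lt_of_le (show x ≤ 1 from le_trans hqx hq1) with hx1 | hx1
  · have hq : q = 1 := le_antisymm hq1 (hx1 ▸ hqx)
    rw [hq]
    nlinarith [P3]
  · have hpos : 0 < 1 - x := by linarith
    nlinarith [hprod1, hprod2, hkey, hpos]

/-- **Abstract sure shift.**  If `T` (with `T 0 = 1`, `T ≥ 0`) has the gap property at `E` and `x ≤ 1`, then `t ↦ T(t − s)` has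
the gap property at `E + 2s`: sure mass `s` is worth `2s`. [this work] -/
theorem gapFun_shift (x : ℝ) (hx1 : x ≤ 1) (T : ℕ → ℝ) (hT0 : T 0 = 1) (hTnn : ∀ t, 0 ≤ T t) (E : ℕ)
    (hU : ∀ y v : ℕ, y ≤ v → y + v ≤ E + 1 → x ≤ x * T y + (1 - x) * T v) (s : ℕ) :
    ∀ y v : ℕ, y ≤ v → y + v ≤ E + 2 * s + 1 → x ≤ x * T (y - s) + (1 - x) * T (v - s) := by
  intro y v hyv hsum
  by_cases hys : s < y
  · exact hU (y - s) (v - s) (by omega) (by omega)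
  · have h0 : y - s = 0 := by omega
    rw [h0, hT0]
    nlinarith [hTnn (v - s)]

/-! ### 2. The pair extension lemma -/

/-- **The five-component decomposition of a companion pair** (pure algebra).  For a floor `1/2 ≤ x < 1`, a heavy gate
`x ≤ q ≤ 1` and any gate `0 ≤ g ≤ 1` with `x(1 − q)(1 − g) ≤ (1 − x)·q·g` there are weights `W₁, …, W₅ ≥ 0` with
`q(g·z₃ + (1−g)·z₂) + (1−q)(g·z₁ + (1−g)·z₀) = W₁(x z₃ + (1−x) z₀) + W₂(x z₃ + (1−x) z₁) + W₃(x z₂ + (1−x) z₁) + W₄ z₂ + W₅ z₃`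
identically in `z₀, z₁, z₂, z₃` (so `Σ W = 1`): `W₁ = (1−q)(1−g)/(1−x)`, `W₃ = θ = max(0, (r(1−q) − qg)/x)`,
`W₂ = (1−q)g/(1−x) − θ`, `W₄ = q(1−g) − xθ`, `W₅ = qg − r(1−q) + xθ`, `r = x/(1−x)`. [this work] -/
theorem pairDecomp (x q g : ℝ) (hx : 1 / 2 ≤ x) (hx1 : x < 1) (hqx : x ≤ q) (hq1 : q ≤ 1) (hg0 : 0 ≤ g) (hg1 : g ≤ 1)
    (hodds : x * (1 - q) * (1 - g) ≤ (1 - x) * q * g) :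
    ∃ W₁ W₂ W₃ W₄ W₅ : ℝ, 0 ≤ W₁ ∧ 0 ≤ W₂ ∧ 0 ≤ W₃ ∧ 0 ≤ W₄ ∧ 0 ≤ W₅ ∧ W₁ + W₂ + W₃ + W₄ + W₅ = 1 ∧
      ∀ z₀ z₁ z₂ z₃ : ℝ, q * (g * z₃ + (1 - g) * z₂) + (1 - q) * (g * z₁ + (1 - g) * z₀) =
        W₁ * (x * z₃ + (1 - x) * z₀) + W₂ * (x * z₃ + (1 - x) * z₁) + W₃ * (x * z₂ + (1 - x) * z₁) + W₄ * z₂ + W₅ * z₃ := by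
  have hx0 : 0 < x := by linarith
  have h1x : 0 < 1 - x := by linarith
  have hq0 : 0 ≤ q := le_trans hx0.le hqx
  have h1q : 0 ≤ 1 - q := by linarith
  have h1g : 0 ≤ 1 - g := by linarith
  set r : ℝ := x / (1 - x) with hr
  have hr' : r * (1 - x) = x := by rw [hr]; field_simp
  set θ : ℝ := max 0 ((r * (1 - q) - q * g) / x) with hθ
  have hθ0 : 0 ≤ θ := le_max_left _ _
  have hθge : r * (1 - q) - q * g ≤ x * θ := by
    have h := mul_le_mul_of_nonneg_left (le_max_right 0 ((r * (1 - q) - q * g) / x)) hx0.le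
    rwa [mul_div_cancel₀ _ hx0.ne'] at h
  have hrq : r * (1 - q) ≤ q := by
    have : r * (1 - q) * (1 - x) = x * (1 - q) := by rw [mul_right_comm, hr']
    nlinarith
  -- θ ≤ (1 − q)g/(1 − x): the odds condition
  have hθle1 : θ * (1 - x) ≤ (1 - q) * g := by
    rcases le_total 0 ((r * (1 - q) - q * g) / x) with hpos | hneg
    · have hθeq : θ = (r * (1 - q) - q * g) / x := max_eq_right hpos
      have : θ * x = r * (1 - q) - q * g := by rw [hθeq]; field_simp
      -- (r(1−q) − qg)(1−x) ≤ (1−q) g x  ⟸  x(1−q)(1−g) ≤ (1−x) q g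
      nlinarith [hr', hodds]
    · have hθeq : θ = 0 := max_eq_left hneg
      rw [hθeq, zero_mul]; exact mul_nonneg h1q hg0
  -- xθ ≤ q(1 − g): the companion is heavy
  have hθle2 : x * θ ≤ q * (1 - g) := by
    rcases le_total 0 ((r * (1 - q) - q * g) / x) with hpos | hneg
    · have hθeq : θ = (r * (1 - q) - q * g) / x := max_eq_right hpos
      have : x * θ = r * (1 - q) - q * g := by rw [hθeq]; field_simp
      linarith
    · have hθeq : θ = 0 := max_eq_left hneg
      rw [hθeq, mul_zero]; exact mul_nonneg hq0 h1g
  refine ⟨(1 - q) * (1 - g) / (1 - x), (1 - q) * g / (1 - x) - θ, θ, q * (1 - g) - x * θ,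
    q * g - r * (1 - q) + x * θ, div_nonneg (mul_nonneg h1q h1g) h1x.le, ?_, hθ0, by linarith, by linarith, ?_, ?_⟩
  · rw [sub_nonneg, le_div_iff₀ h1x]; exact hθle1
  · rw [hr]; field_simp; ring
  · intro z₀ z₁ z₂ z₃
    rw [hr]; field_simp; ring

/-- **THE PAIR EXTENSION LEMMA.**  Gates in `[0,1]` on `U`, floor `1/2 ≤ x < 1`; `U` has the gap property at `E`; `k, ℓ ∉ U`,
`k ≠ ℓ`, the companion `k` heavy (`x ≤ p k ≤ 1`), the light blob `ℓ` of any gate `0 ≤ p ℓ ≤ 1` with `a ℓ ≤ a k` and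
`x(1 − p k)(1 − p ℓ) ≤ (1 − x)·p k·p ℓ`.  Then `U + ℓ + k` has the gap property at `E + a k + a ℓ`.
Proof: with `a = a k`, `b = a ℓ`, `T = TL_U`,
`TL_{U+ℓ+k}(t) = pg·T(t−a−b) + p(1−g)·T(t−a) + (1−p)g·T(t−b) + (1−p)(1−g)·T(t)` is, by `pairDecomp`, a convex combination of
`xT(t−a−b) + (1−x)T(t)`, `xT(t−a−b) + (1−x)T(t−b)`, `xT(t−a) + (1−x)T(t−b)`, `T(t−a)`, `T(t−a−b)` — an abstract floor blob of size
`a+b` / `a` / `a−b` on top of a sure shift by `0` / `b` / `b`, and sure shifts by `a`, `a+b` — each of which has the gap property at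
`E + a + b` (`gapFun_extend`, `gapFun_shift`). [this work] -/
theorem gap_insert_pair (p : κ → ℝ) (a : κ → ℕ) (x : ℝ) (hx : 1 / 2 ≤ x) (hx1 : x < 1) (U : Finset κ)
    (hp0 : ∀ i ∈ U, 0 ≤ p i) (hp1 : ∀ i ∈ U, p i ≤ 1) (k ℓ : κ) (hk : k ∉ U) (hℓ : ℓ ∉ U) (hkℓ : k ≠ ℓ)
    (hkx : x ≤ p k) (hk1 : p k ≤ 1) (hg0 : 0 ≤ p ℓ) (hg1 : p ℓ ≤ 1) (hba : a ℓ ≤ a k)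
    (hodds : x * (1 - p k) * (1 - p ℓ) ≤ (1 - x) * p k * p ℓ) (E : ℕ)
    (hU : ∀ y v : ℕ, y ≤ v → y + v ≤ E + 1 →
      x ≤ x * (∑ s ∈ U.powerset, (∏ i ∈ U, (if i ∈ s then p i else 1 - p i)) *
              (if y ≤ ∑ i ∈ s, a i then (1 : ℝ) else 0)) +
          (1 - x) * (∑ s ∈ U.powerset, (∏ i ∈ U, (if i ∈ s then p i else 1 - p i)) *
              (if v ≤ ∑ i ∈ s, a i then (1 : ℝ) else 0))) :
    ∀ y v : ℕ, y ≤ v → y + v ≤ E + a k + a ℓ + 1 →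
      x ≤ x * (∑ s ∈ (insert k (insert ℓ U)).powerset,
              (∏ i ∈ insert k (insert ℓ U), (if i ∈ s then p i else 1 - p i)) *
              (if y ≤ ∑ i ∈ s, a i then (1 : ℝ) else 0)) +
          (1 - x) * (∑ s ∈ (insert k (insert ℓ U)).powerset,
              (∏ i ∈ insert k (insert ℓ U), (if i ∈ s then p i else 1 - p i)) *
              (if v ≤ ∑ i ∈ s, a i then (1 : ℝ) else 0)) := by
  intro y v hyv hsum
  have hkℓU : k ∉ insert ℓ U := by
    rw [Finset.mem_insert]; exact fun h => h.elim hkℓ hk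
  rw [tailU_insert p a (insert ℓ U) k hkℓU y, tailU_insert p a (insert ℓ U) k hkℓU v,
    tailU_insert p a U ℓ hℓ (y - a k), tailU_insert p a U ℓ hℓ y,
    tailU_insert p a U ℓ hℓ (v - a k), tailU_insert p a U ℓ hℓ v]
  set T : ℕ → ℝ := fun t => ∑ s ∈ U.powerset, (∏ i ∈ U, (if i ∈ s then p i else 1 - p i)) *
      (if t ≤ ∑ i ∈ s, a i then (1 : ℝ) else 0) with hT
  have hT0 : T 0 = 1 := by simp only [hT]; exact tailU_zero p a U
  have hTnn : ∀ t, 0 ≤ T t := fun t => by simp only [hT]; exact tailU_nonneg p a U hp0 hp1 t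
  have hTanti : ∀ t t' : ℕ, t ≤ t' → T t' ≤ T t := fun t t' htt => by
    simp only [hT]; exact tailU_antitone p a U hp0 hp1 htt
  have hU' : ∀ y v : ℕ, y ≤ v → y + v ≤ E + 1 → x ≤ x * T y + (1 - x) * T v := fun y v h1 h2 => by
    simp only [hT]; exact hU y v h1 h2
  set q := p k with hq
  set g := p ℓ with hg
  set A := a k with hA
  set b := a ℓ with hb
  have hsub : ∀ t : ℕ, t - A - b = t - (A + b) := fun t => by omega
  change x ≤ x * (q * (g * T (y - A - b) + (1 - g) * T (y - A)) + (1 - q) * (g * T (y - b) + (1 - g) * T y)) +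
    (1 - x) * (q * (g * T (v - A - b) + (1 - g) * T (v - A)) + (1 - q) * (g * T (v - b) + (1 - g) * T v))
  rw [hsub y, hsub v]
  have hx1' : x ≤ 1 := hx1.le
  -- the five component inequalities at the pair (y, v)
  have C1 : x ≤ x * (x * T (y - (A + b)) + (1 - x) * T y) + (1 - x) * (x * T (v - (A + b)) + (1 - x) * T v) :=
    gapFun_extend x hx T hT0 hTnn hTanti E hU' x le_rfl hx1' (A + b) y v hyv (by omega)
  have hSb := gapFun_shift x hx1' T hT0 hTnn E hU' b
  have hSb0 : (fun t => T (t - b)) 0 = 1 := by simp [hT0]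
  have hSbnn : ∀ t, 0 ≤ (fun t => T (t - b)) t := fun t => hTnn _
  have hSbanti : ∀ t t' : ℕ, t ≤ t' → (fun t => T (t - b)) t' ≤ (fun t => T (t - b)) t :=
    fun t t' htt => hTanti _ _ (by omega)
  have C2' := gapFun_extend x hx (fun t => T (t - b)) hSb0 hSbnn hSbanti (E + 2 * b) hSb x le_rfl hx1' A y v hyv (by omega)
  have e1 : y - A - b = y - (A + b) := by omega
  have e2 : v - A - b = v - (A + b) := by omega
  have C2 : x ≤ x * (x * T (y - (A + b)) + (1 - x) * T (y - b)) + (1 - x) * (x * T (v - (A + b)) + (1 - x) * T (v - b)) := by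
    rw [e1, e2] at C2'
    exact C2'
  have C3' := gapFun_extend x hx (fun t => T (t - b)) hSb0 hSbnn hSbanti (E + 2 * b) hSb x le_rfl hx1' (A - b) y v hyv
    (by omega)
  have e3 : y - (A - b) - b = y - A := by omega
  have e4 : v - (A - b) - b = v - A := by omega
  have C3 : x ≤ x * (x * T (y - A) + (1 - x) * T (y - b)) + (1 - x) * (x * T (v - A) + (1 - x) * T (v - b)) := by
    rw [e3, e4] at C3'
    exact C3'
  have C4 : x ≤ x * T (y - A) + (1 - x) * T (v - A) := gapFun_shift x hx1' T hT0 hTnn E hU' A y v hyv (by omega)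
  have C5 : x ≤ x * T (y - (A + b)) + (1 - x) * T (v - (A + b)) :=
    gapFun_shift x hx1' T hT0 hTnn E hU' (A + b) y v hyv (by omega)
  -- decompose and combine
  obtain ⟨W₁, W₂, W₃, W₄, W₅, hW₁, hW₂, hW₃, hW₄, hW₅, hsumW, hdec⟩ :=
    pairDecomp x q g hx hx1 hkx hk1 hg0 hg1 hodds
  rw [hdec (T y) (T (y - b)) (T (y - A)) (T (y - (A + b))), hdec (T v) (T (v - b)) (T (v - A)) (T (v - (A + b)))]
  have hc1 := mul_le_mul_of_nonneg_left C1 hW₁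
  have hc2 := mul_le_mul_of_nonneg_left C2 hW₂
  have hc3 := mul_le_mul_of_nonneg_left C3 hW₃
  have hc4 := mul_le_mul_of_nonneg_left C4 hW₄
  have hc5 := mul_le_mul_of_nonneg_left C5 hW₅
  have hid : x * (W₁ * (x * T (y - (A + b)) + (1 - x) * T y) + W₂ * (x * T (y - (A + b)) + (1 - x) * T (y - b)) +
        W₃ * (x * T (y - A) + (1 - x) * T (y - b)) + W₄ * T (y - A) + W₅ * T (y - (A + b))) +
      (1 - x) * (W₁ * (x * T (v - (A + b)) + (1 - x) * T v) + W₂ * (x * T (v - (A + b)) + (1 - x) * T (v - b)) +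
        W₃ * (x * T (v - A) + (1 - x) * T (v - b)) + W₄ * T (v - A) + W₅ * T (v - (A + b))) =
      W₁ * (x * (x * T (y - (A + b)) + (1 - x) * T y) + (1 - x) * (x * T (v - (A + b)) + (1 - x) * T v)) +
      W₂ * (x * (x * T (y - (A + b)) + (1 - x) * T (y - b)) + (1 - x) * (x * T (v - (A + b)) + (1 - x) * T (v - b))) +
      W₃ * (x * (x * T (y - A) + (1 - x) * T (y - b)) + (1 - x) * (x * T (v - A) + (1 - x) * T (v - b))) +
      W₄ * (x * T (y - A) + (1 - x) * T (v - A)) +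
      W₅ * (x * T (y - (A + b)) + (1 - x) * T (v - (A + b))) := by ring
  have hxs : x = W₁ * x + W₂ * x + W₃ * x + W₄ * x + W₅ * x := by linear_combination (-x) * hsumW
  rw [hid]
  linarith [hc1, hc2, hc3, hc4, hc5, hxs]

/-! ### 3. Matched companions -/

/-- **A matched family of lights adds its full size.**  Gates in `[0,1]`, floor `1/2 ≤ x < 1`; `S` has the gap property at `E`;
`L` a finset of blobs disjoint from `S` with a companion map `c`, injective on `L`, `c ℓ ∉ S`, `c ℓ ∉ L`, and for every `ℓ ∈ L`:
`x ≤ p (c ℓ)`, `a ℓ ≤ a (c ℓ)`, `x(1 − p (c ℓ))(1 − p ℓ) ≤ (1 − x) p (c ℓ) p ℓ`.  Then `S ∪ L ∪ c(L)` has the gap property at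
`E + Σ_{ℓ ∈ L} (a ℓ + a (c ℓ))`. [this work] -/
theorem gap_union_pairs (p : κ → ℝ) (a : κ → ℕ) (x : ℝ) (hx : 1 / 2 ≤ x) (hx1 : x < 1) (hp0 : ∀ i, 0 ≤ p i)
    (hp1 : ∀ i, p i ≤ 1) (S : Finset κ) (E : ℕ)
    (hS : ∀ y v : ℕ, y ≤ v → y + v ≤ E + 1 →
      x ≤ x * (∑ s ∈ S.powerset, (∏ i ∈ S, (if i ∈ s then p i else 1 - p i)) *
              (if y ≤ ∑ i ∈ s, a i then (1 : ℝ) else 0)) +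
          (1 - x) * (∑ s ∈ S.powerset, (∏ i ∈ S, (if i ∈ s then p i else 1 - p i)) *
              (if v ≤ ∑ i ∈ s, a i then (1 : ℝ) else 0)))
    (c : κ → κ) (L : Finset κ) (hLS : Disjoint L S) (hcS : ∀ ℓ ∈ L, c ℓ ∉ S) (hcL : ∀ ℓ ∈ L, c ℓ ∉ L)
    (hcinj : ∀ ℓ₁ ∈ L, ∀ ℓ₂ ∈ L, c ℓ₁ = c ℓ₂ → ℓ₁ = ℓ₂)
    (hcx : ∀ ℓ ∈ L, x ≤ p (c ℓ)) (hsize : ∀ ℓ ∈ L, a ℓ ≤ a (c ℓ))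
    (hodds : ∀ ℓ ∈ L, x * (1 - p (c ℓ)) * (1 - p ℓ) ≤ (1 - x) * p (c ℓ) * p ℓ) :
    ∀ y v : ℕ, y ≤ v → y + v ≤ E + (∑ ℓ ∈ L, (a ℓ + a (c ℓ))) + 1 →
      x ≤ x * (∑ s ∈ (S ∪ L ∪ L.image c).powerset, (∏ i ∈ S ∪ L ∪ L.image c, (if i ∈ s then p i else 1 - p i)) *
              (if y ≤ ∑ i ∈ s, a i then (1 : ℝ) else 0)) +
          (1 - x) * (∑ s ∈ (S ∪ L ∪ L.image c).powerset, (∏ i ∈ S ∪ L ∪ L.image c, (if i ∈ s then p i else 1 - p i)) *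
              (if v ≤ ∑ i ∈ s, a i then (1 : ℝ) else 0)) := by
  induction L using Finset.induction_on with
  | empty =>
    intro y v hyv hsum
    simp only [Finset.union_empty, Finset.image_empty, Finset.sum_empty, add_zero] at hsum ⊢
    exact hS y v hyv hsum
  | @insert ℓ L hℓL ih =>
    intro y v hyv hsum
    have hLS' : Disjoint L S := Finset.disjoint_of_subset_left (Finset.subset_insert ℓ L) hLS
    have hmem : ∀ {i}, i ∈ L → i ∈ insert ℓ L := fun hi => Finset.mem_insert_of_mem hi
    have ih' := ih hLS' (fun i hi => hcS i (hmem hi)) (fun i hi h => hcL i (hmem hi) (hmem h))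
      (fun i hi j hj h => hcinj i (hmem hi) j (hmem hj) h) (fun i hi => hcx i (hmem hi))
      (fun i hi => hsize i (hmem hi)) (fun i hi => hodds i (hmem hi))
    set U : Finset κ := S ∪ L ∪ L.image c with hU
    have hℓself : ℓ ∈ insert ℓ L := Finset.mem_insert_self ℓ L
    have hℓS : ℓ ∉ S := Finset.disjoint_left.mp hLS hℓself
    have hℓU : ℓ ∉ U := by
      rw [hU, Finset.mem_union, Finset.mem_union, Finset.mem_image]
      rintro ((h | h) | ⟨i, hi, hic⟩)
      · exact hℓS h
      · exact hℓL h
      · exact hcL i (hmem hi) (hic ▸ hℓself)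
    have hcℓU : c ℓ ∉ U := by
      rw [hU, Finset.mem_union, Finset.mem_union, Finset.mem_image]
      rintro ((h | h) | ⟨i, hi, hic⟩)
      · exact hcS ℓ hℓself h
      · exact hcL ℓ hℓself (hmem h)
      · exact hℓL ((hcinj i (hmem hi) ℓ hℓself hic) ▸ hi)
    have hcℓℓ : c ℓ ≠ ℓ := fun h => hcL ℓ hℓself (by rw [h]; exact hℓself)
    have hset : S ∪ insert ℓ L ∪ (insert ℓ L).image c = insert (c ℓ) (insert ℓ U) := by
      ext i
      simp only [hU, Finset.mem_union, Finset.mem_insert, Finset.mem_image]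
      constructor
      · rintro ((h | h) | ⟨j, hj, hjc⟩)
        · exact Or.inr (Or.inr (Or.inl (Or.inl h)))
        · rcases h with h | h
          · exact Or.inr (Or.inl h)
          · exact Or.inr (Or.inr (Or.inl (Or.inr h)))
        · rcases hj with hj | hj
          · exact Or.inl (by rw [← hjc, hj])
          · exact Or.inr (Or.inr (Or.inr ⟨j, hj, hjc⟩))
      · rintro (h | h | ((h | h) | ⟨j, hj, hjc⟩))
        · exact Or.inr ⟨ℓ, Or.inl rfl, h.symm⟩
        · exact Or.inl (Or.inr (Or.inl h))
        · exact Or.inl (Or.inl h)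
        · exact Or.inl (Or.inr (Or.inr h))
        · exact Or.inr ⟨j, Or.inr hj, hjc⟩
    rw [hset]
    have hstep := gap_insert_pair p a x hx hx1 U (fun i _ => hp0 i) (fun i _ => hp1 i) (c ℓ) ℓ hcℓU hℓU
      hcℓℓ (hcx ℓ hℓself) (hp1 (c ℓ)) (hp0 ℓ) (hp1 ℓ) (hsize ℓ hℓself) (hodds ℓ hℓself)
      (E + ∑ i ∈ L, (a i + a (c i))) ih'
    refine hstep y v hyv ?_
    rw [Finset.sum_insert hℓL] at hsum
    omega

/-- **THE MATCHING ROW** (credit-free).  Gates in `[0,1]`, floor `1/2 ≤ x < 1`, a layer `j`.  A finset `L` of blobs (the lights,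
of any gates) with a companion map `c`: injective on `L`, `c ℓ ∉ L`, the companion heavy (`x ≤ p (c ℓ)`), at least as large
(`a ℓ ≤ a (c ℓ)`) and reliable enough (`x(1 − p (c ℓ))(1 − p ℓ) ≤ (1 − x)·p (c ℓ)·p ℓ`, i.e. `odds(p (c ℓ))·odds(p ℓ) ≥ odds(x)`);
every blob outside `L` heavy; sizes totalling `2j + 1 ≤ Σ a`.  Then `x ≤ P(N ≥ j+1)`: matched lights count at FULL size in the size
row.  With all light gates `≥ 1/2` the odds condition holds for any heavy companion. [this work] -/
theorem tail_ge_of_matched_companions [Fintype κ] (p : κ → ℝ) (a : κ → ℕ) (x : ℝ) (hx : 1 / 2 ≤ x) (hx1 : x < 1)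
    (hp0 : ∀ i, 0 ≤ p i) (hp1 : ∀ i, p i ≤ 1) (L : Finset κ) (c : κ → κ) (hcL : ∀ ℓ ∈ L, c ℓ ∉ L)
    (hcinj : ∀ ℓ₁ ∈ L, ∀ ℓ₂ ∈ L, c ℓ₁ = c ℓ₂ → ℓ₁ = ℓ₂) (hcx : ∀ ℓ ∈ L, x ≤ p (c ℓ))
    (hsize : ∀ ℓ ∈ L, a ℓ ≤ a (c ℓ)) (hodds : ∀ ℓ ∈ L, x * (1 - p (c ℓ)) * (1 - p ℓ) ≤ (1 - x) * p (c ℓ) * p ℓ)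
    (hheavy : ∀ k, k ∉ L → x ≤ p k) (j : ℕ) (htot : 2 * j + 1 ≤ ∑ i, a i) :
    x ≤ ∑ s : Finset κ, (∏ i, (if i ∈ s then p i else 1 - p i)) * (if j + 1 ≤ ∑ i ∈ s, a i then (1 : ℝ) else 0) := by
  -- the matched set `L ∪ c(L)` has the gap property at its total size
  have hS : ∀ y v : ℕ, y ≤ v → y + v ≤ 0 + 1 →
      x ≤ x * (∑ s ∈ (∅ : Finset κ).powerset, (∏ i ∈ (∅ : Finset κ), (if i ∈ s then p i else 1 - p i)) *
              (if y ≤ ∑ i ∈ s, a i then (1 : ℝ) else 0)) +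
          (1 - x) * (∑ s ∈ (∅ : Finset κ).powerset, (∏ i ∈ (∅ : Finset κ), (if i ∈ s then p i else 1 - p i)) *
              (if v ≤ ∑ i ∈ s, a i then (1 : ℝ) else 0)) := by
    intro y v hyv hsum
    have hy : y = 0 := by omega
    subst hy
    rw [tailU_zero p a ∅]
    have hnn := tailU_nonneg p a (∅ : Finset κ) (fun i _ => hp0 i) (fun i _ => hp1 i) v
    nlinarith [mul_nonneg (sub_nonneg.mpr hx1.le) hnn]
  have hpairs := gap_union_pairs p a x hx hx1 hp0 hp1 ∅ 0 hS c L (Finset.disjoint_empty_right _)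
    (fun ℓ _ => Finset.notMem_empty _) hcL hcinj hcx hsize hodds
  rw [Finset.empty_union, zero_add] at hpairs
  -- split: S = L ∪ c(L), the rest heavy
  refine tail_ge_of_gapCert p a x hx hx1.le hp0 hp1 (L ∪ L.image c) ?_ j ?_
  · intro k hk
    rw [Finset.mem_union, not_or] at hk
    exact hheavy k hk.1
  · intro y v hyv hsum
    refine hpairs y v hyv ?_
    -- Σ_{L} (a ℓ + a (c ℓ)) = Σ_{L ∪ c(L)} a, and Σ_{(L ∪ c(L))ᶜ} a + Σ_{L ∪ c(L)} a = Σ a ≥ 2j+1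
    have hdisj : Disjoint L (L.image c) := by
      rw [Finset.disjoint_left]
      intro i hi hi'
      obtain ⟨j', hj', hjc⟩ := Finset.mem_image.mp hi'
      exact hcL j' hj' (hjc ▸ hi)
    have hsumL : ∑ ℓ ∈ L, (a ℓ + a (c ℓ)) = ∑ i ∈ L ∪ L.image c, a i := by
      rw [Finset.sum_union hdisj, Finset.sum_add_distrib, Finset.sum_image]
      exact fun i hi j' hj' h => hcinj i hi j' hj' h
    have hcompl : ∑ i ∈ (L ∪ L.image c)ᶜ, a i + ∑ i ∈ L ∪ L.image c, a i = ∑ i, a i :=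
      Finset.sum_compl_add_sum _ _
    omega

end IndepBlob

end Quant

end Summit.CriticalPhenomena.PercolationContinuityZ3.Theorems
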